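import Summits.AnomalousDissipation.AnomalousDissipation.Theorems.SolenoidalFractalHomogenisationLagrangianStepSidebandMask
import Summits.AnomalousDissipation.AnomalousDissipation.Theorems.SolenoidalFractalHomogenisationLagrangianStepSidebandOwnSlot
import HarnessLib

/-!
# K1L_D `stub_D1_residueTail` (registry v17, stmt-AnomalousDissipation-27980) — lane A4 brick E-2: OFF-FIBRE DECAY IN THE SOURCE SLOT — for an
# adjacent NON-COLINEAR slot pair the pickup reads only the part of the response that crossed the whole source slot without forcing
# (helper; `--supports stmt-AnomalousDissipation-27980`)

Summits-side helper file of route `SolenoidalFractalHomogenisation` (prover seat `ad-sawtooth-k1loc-p1` g13, lane A owner; case E of the tail certificate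
`Lines/onelevel-D1-tail-cert.md` §3 — "the one new analytic input").  Everything proved; no definitions, no named facts, no sorry.
Setting: source slot `j'` (`m' = m_{j'}`), pickup slot `j` (`m = mⱼ`) with `m' ∉ ℤm` (non-colinear) and the pickup window starting where the source slot ends,
up to a period shift `p` (`startⱼ + pP = start_{j'} + τ_{j'}`; `p = 1` for the wrap pair `(0, k₀−1)`); `N̄ = responseExt … j'`, `r = min γ₁ (4π²lo')`.
* `slotEnvelope_add_int_mul_period` — the envelopes are `P`-periodic (integer multiples);
* `maskL_source_eq_zero` — a mask avoiding `±m'` kills the source of slot `j'`;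
* **`norm_maskL_offLadder_le`** — with `A₂ = {z | z ∉ ±m' + ℤm}`: for `t` in the pickup slot,
  `‖maskL A₂ (N̄ (t + pP) v)‖ ≤ e^{−r·τ_{j'}} · ‖N̄ start_{j'} v‖`.  Two stages: during the source slot the set `A₁ = {z ≠ ±m'}` is closed (the only active links
  run along `m'`, and the readers of `±m'` sit at `±2m'`, where the coefficient `ê'·(±2m') = 0` — `linkCoeff_eq_zero_of_ladder`) and is not forced, so that
  part decays by `e^{−rτ_{j'}}`; during the pickup slot the smaller set `A₂ ⊆ A₁` is closed (links run along `m`; `±m' + ℤm` is a union of `m`-ladders) and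
  still unforced;
* `self_mem_offLadder`, `neg_self_mem_offLadder`, **`feedback_maskL_offLadder`** — `±m ∈ A₂` (non-colinearity), so `feedbackⱼ(t) y = feedbackⱼ(t) (maskL A₂ y)`:
  the fresh injection of slot `j'` is INVISIBLE to the pickup of slot `j`, and what is visible has decayed through the whole source slot.
NOT a proof of any registered stub, of the crux, or of anomalous dissipation; rung leaf F-D1 infrastructure.
-/

set_option linter.dupNamespace false

noncomputable section

namespace Summit.AnomalousDissipation.AnomalousDissipation.Theorems.SolenoidalFractalHomogenisation.LagrangianStep.Sideband

open Set MeasureTheory Complex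
open scoped InnerProductSpace
open Literature.Analysis Literature.Analysis.FunctionSpaces Literature.Analysis.FunctionSpaces.Torus
open Literature.Analysis.FluidPDE Literature.Analysis.FluidPDE.Torus Literature.Analysis.FluidPDE.LatticeShear
open Summit.AnomalousDissipation.AnomalousDissipation.Theorems.SolenoidalFractalHomogenisation.LagrangianStep.CellChain (linkCoeff)
open Summit.AnomalousDissipation.AnomalousDissipation.Theorems.SolenoidalFractalHomogenisation.PermissibleCarrier (period_pos start_nonneg start_add_tau_le_period)

variable {k₀ : ℕ}

/-! ## §1 Periodicity of the envelopes and the support of the source -/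

/-- The envelopes are `P`-periodic (integer multiples). [cite: ArmstrongVicol2025, §4 p. 17 (time cutoff)] -/
theorem slotEnvelope_add_int_mul_period (W₁ : LatticeWord k₀) (i : Fin k₀) (t : ℝ) (p : ℤ) :
    slotEnvelope W₁ i (t + p * W₁.period) = slotEnvelope W₁ i t := by
  have hP : W₁.period ≠ 0 := (period_pos W₁).ne'
  rw [slotEnvelope_def, slotEnvelope_def, add_div, mul_div_cancel_right₀ _ hP, Int.fract_add_intCast]

/-- During the (shifted) window of slot `j` every other envelope vanishes. [folklore] -/
theorem slotEnvelope_eq_zero_of_mem_shifted_slot (W₁ : LatticeWord k₀) {i j : Fin k₀} (hij : i ≠ j) (p : ℤ) {u : ℝ}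
    (hu : u - p * W₁.period ∈ Ico (W₁.start j) (W₁.start j + (W₁.phase j).τ)) : slotEnvelope W₁ i u = 0 := by
  have h := slotEnvelope_eq_zero_of_mem_slot W₁ hij hu
  rwa [show u - p * W₁.period = u + (-p : ℤ) * W₁.period by push_cast; ring, slotEnvelope_add_int_mul_period] at h

/-- **A mask avoiding `±m_{j'}` kills the source of slot `j'`.** [cite: MajdaKramer1999, §2.2.1.3 (cell problem (49), source term)] -/
theorem maskL_source_eq_zero (W₁ : LatticeWord k₀) (R : ℕ) (j' : Fin k₀) (t : ℝ) (v : EuclideanSpace ℂ (Fin 3)) {A : Set (Fin 3 → ℤ)}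
    (h₁ : (W₁.phase j').m ∉ A) (h₂ : -(W₁.phase j').m ∉ A) : maskL R A (source W₁ R j' t v) = 0 := by
  ext z : 1
  by_cases hz : (z : Fin 3 → ℤ) ∈ A
  · rw [maskL_apply_of_mem hz, source_apply, sourceComp]
    have hz1 : (z : Fin 3 → ℤ) ≠ (W₁.phase j').m := fun h => h₁ (h ▸ hz)
    have hz2 : (z : Fin 3 → ℤ) ≠ -(W₁.phase j').m := fun h => h₂ (h ▸ hz)
    simp [hz1, hz2]
  · rw [maskL_apply_of_not_mem hz]; rfl

/-! ## §2 The off-ladder set -/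

/-- `±m` lie off the ladders `±m' + ℤm` when `m' ∉ ℤm`. [folklore] -/
theorem self_mem_offLadder {m m' : Fin 3 → ℤ} (hnc : ∀ c : ℤ, m' ≠ c • m) :
    m ∈ {z : Fin 3 → ℤ | ∀ d : ℤ, z ≠ m' + d • m ∧ z ≠ -m' + d • m} := by
  intro d
  constructor
  · intro h
    have h2 : m - d • m = m' + d • m - d • m := congrArg (· - d • m) h
    exact hnc (1 - d) (by rw [sub_smul, one_smul, h2, add_sub_cancel_right])
  · intro h
    have h2 : d • m - m = d • m - (-m' + d • m) := congrArg (d • m - ·) h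
    exact hnc (d - 1) (by rw [sub_smul, one_smul, h2]; abel)

/-- `−m` lies off the ladders `±m' + ℤm` when `m' ∉ ℤm`. [folklore] -/
theorem neg_self_mem_offLadder {m m' : Fin 3 → ℤ} (hnc : ∀ c : ℤ, m' ≠ c • m) :
    -m ∈ {z : Fin 3 → ℤ | ∀ d : ℤ, z ≠ m' + d • m ∧ z ≠ -m' + d • m} := by
  intro d
  constructor
  · intro h
    have h2 : -m - d • m = m' + d • m - d • m := congrArg (· - d • m) h
    exact hnc (-1 - d) (by rw [sub_smul, neg_smul, one_smul, h2, add_sub_cancel_right])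
  · intro h
    have h2 : d • m - -m = d • m - (-m' + d • m) := congrArg (d • m - ·) h
    exact hnc (d + 1) (by rw [add_smul, one_smul, ← sub_neg_eq_add, h2]; abel)

/-- **The pickup of slot `j` reads through the off-ladder mask** (`±mⱼ ∈ A`). [cite: MajdaKramer1999, §2.2.1.3 (55)] -/
theorem feedback_maskL_of_mem (W₁ : LatticeWord k₀) (R : ℕ) (j : Fin k₀) (t : ℝ) {A : Set (Fin 3 → ℤ)} (h₁ : (W₁.phase j).m ∈ A)
    (h₂ : -(W₁.phase j).m ∈ A) (y : Space R) : feedback W₁ R j t (maskL R A y) = feedback W₁ R j t y := by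
  rw [feedback_apply, feedback_apply, coordL_maskL_of_mem h₁, coordL_maskL_of_mem h₂]

/-! ## §3 Off-fibre decay through the source slot -/

/-- **OFF-LADDER DECAY THROUGH THE SOURCE SLOT.**  Source slot `j'`, pickup slot `j`, `startⱼ + pP = start_{j'} + τ_{j'}`; `N̄ = responseExt … j'`
(`NearIso 𝔸 lo' hi'`, `lo' ≥ 0`, the response of slot `j'` periodic); `A₂ = {z | ∀ d, z ≠ ±m_{j'} + d•mⱼ}`.  For `t ∈ [startⱼ, startⱼ + τⱼ]`:
`‖maskL A₂ (N̄ (t + pP) v)‖ ≤ e^{−min(γ₁,4π²lo')·τ_{j'}} · ‖N̄ start_{j'} v‖`. [cite: SandersVerhulstMurdock2007, Lemma 5.2.7 (linear case)]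
[cite: MeshalkinSinai1961, pp. 1700–1705] -/
theorem norm_maskL_offLadder_le (W₁ : LatticeWord k₀) {𝔸 : Torus.Visc4 (Fin 3)} {lo' hi' : ℝ} (h𝔸 : Torus.NearIso 𝔸 lo' hi')
    (hlo' : 0 ≤ lo') {γ₁ : ℝ} (hγ₁ : 0 ≤ γ₁) (R : ℕ) {j j' : Fin k₀} (hjj : j ≠ j') (hN : IsPeriodicResponse W₁ 𝔸 γ₁ R j' (response W₁ 𝔸 γ₁ R j'))
    (p : ℤ) (hadj : W₁.start j + p * W₁.period = W₁.start j' + (W₁.phase j').τ) (v : EuclideanSpace ℂ (Fin 3)) {t : ℝ}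
    (ht : t ∈ Icc (W₁.start j) (W₁.start j + (W₁.phase j).τ)) :
    ‖maskL R {z : Fin 3 → ℤ | ∀ d : ℤ, z ≠ (W₁.phase j').m + d • (W₁.phase j).m ∧ z ≠ -(W₁.phase j').m + d • (W₁.phase j).m}
        (responseExt W₁ 𝔸 γ₁ R j' (t + p * W₁.period) v)‖ ≤
      Real.exp (-(min γ₁ (4 * Real.pi ^ 2 * lo') * (W₁.phase j').τ)) * ‖responseExt W₁ 𝔸 γ₁ R j' (W₁.start j') v‖ := by
  set m := (W₁.phase j).m with hm
  set m' := (W₁.phase j').m with hm'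
  set s' := W₁.start j' with hs'
  set L' := (W₁.phase j').τ with hL'
  set e' := s' + L' with he'
  set N := responseExt W₁ 𝔸 γ₁ R j' with hNd
  set r := min γ₁ (4 * Real.pi ^ 2 * lo') with hr
  set A₁ : Set (Fin 3 → ℤ) := {z | z ≠ m' ∧ z ≠ -m'} with hA₁
  set A₂ : Set (Fin 3 → ℤ) := {z | ∀ d : ℤ, z ≠ m' + d • m ∧ z ≠ -m' + d • m} with hA₂
  have hL'pos : 0 < L' := (W₁.phase j').τ_pos
  have hsub : A₂ ⊆ A₁ := by
    intro z hz
    have h0 := hz 0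
    simp only [zero_smul, add_zero] at h0
    exact h0
  have hm'A₂ : m' ∉ A₂ := fun h => (h 0).1 (by simp)
  have hm'A₂' : -m' ∉ A₂ := fun h => (h 0).2 (by simp)
  have hm'A₁ : m' ∉ A₁ := fun h => h.1 rfl
  have hm'A₁' : -m' ∉ A₁ := fun h => h.2 rfl
  -- Stage 1: the complement of the source fibre is closed and unforced during the source slot
  have h1 : ‖maskL R A₁ (N e' v)‖ ≤ Real.exp (-(r * (e' - s'))) * ‖maskL R A₁ (N s' v)‖ := by
    refine norm_maskL_responseExt_le_exp W₁ h𝔸 hlo' γ₁ R j' hN A₁ v (by rw [he']; linarith) ?_ ?_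
    · intro u hu i z hz w hw hwb hwA
      have hw' : w = m' ∨ w = -m' := by
        by_contra hc
        push Not at hc
        exact hwA ⟨hc.1, hc.2⟩
      by_cases hi : i = j'
      · subst hi
        refine linkCoeff_eq_zero_of_ladder W₁ i u z (m := w) hw' ?_
        rcases hw with rfl | rfl
        · exact Or.inl rfl
        · exact Or.inr rfl
      · exact linkCoeff_eq_zero_of_slotEnvelope W₁ z.1 (slotEnvelope_eq_zero_of_mem_slot W₁ hi (by rw [he'] at hu; exact hu))
    · intro u _
      exact maskL_source_eq_zero W₁ R j' u v hm'A₁ hm'A₁'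
  -- Stage 2: the off-ladder set is closed and unforced during the pickup slot
  have ht' : e' ≤ t + p * W₁.period := by linarith [ht.1, hadj]
  have h2 : ‖maskL R A₂ (N (t + p * W₁.period) v)‖ ≤ Real.exp (-(r * (t + p * W₁.period - e'))) * ‖maskL R A₂ (N e' v)‖ := by
    refine norm_maskL_responseExt_le_exp W₁ h𝔸 hlo' γ₁ R j' hN A₂ v ht' ?_ ?_
    · intro u hu i z hz w hw hwb hwA
      by_cases hi : i = j
      · -- along `mⱼ` the off-ladder set is closed: vacuous
        exfalso
        subst hi
        simp only [hA₂, Set.mem_setOf_eq, not_forall, not_and_or, not_not] at hwA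
        obtain ⟨d, hd⟩ := hwA
        rcases hw with rfl | rfl
        · rcases hd with hd | hd
          · exact (hz (d + 1)).1 (by rw [add_smul, one_smul, ← add_assoc, ← hd, sub_add_cancel])
          · exact (hz (d + 1)).2 (by rw [add_smul, one_smul, ← add_assoc, ← hd, sub_add_cancel])
        · rcases hd with hd | hd
          · exact (hz (d - 1)).1 (by rw [sub_smul, one_smul, ← add_sub_assoc, ← hd, add_sub_cancel_right])
          · exact (hz (d - 1)).2 (by rw [sub_smul, one_smul, ← add_sub_assoc, ← hd, add_sub_cancel_right])
      · refine linkCoeff_eq_zero_of_slotEnvelope W₁ z.1 (slotEnvelope_eq_zero_of_mem_shifted_slot W₁ hi p ?_)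
        constructor
        · linarith [hu.1, hadj]
        · linarith [hu.2, ht.2, hadj]
    · intro u _
      exact maskL_source_eq_zero W₁ R j' u v hm'A₂ hm'A₂'
  -- combine
  have hr0 : 0 ≤ r := le_min hγ₁ (by positivity)
  have hexp2 : Real.exp (-(r * (t + p * W₁.period - e'))) ≤ 1 := by
    rw [Real.exp_le_one_iff, neg_nonpos]
    exact mul_nonneg hr0 (by linarith)
  calc ‖maskL R A₂ (N (t + p * W₁.period) v)‖
      ≤ Real.exp (-(r * (t + p * W₁.period - e'))) * ‖maskL R A₂ (N e' v)‖ := h2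
    _ ≤ ‖maskL R A₂ (N e' v)‖ := mul_le_of_le_one_left (norm_nonneg _) hexp2
    _ = ‖maskL R A₂ (maskL R A₁ (N e' v))‖ := by rw [maskL_maskL_of_subset hsub]
    _ ≤ ‖maskL R A₁ (N e' v)‖ := norm_maskL_le _ _
    _ ≤ Real.exp (-(r * (e' - s'))) * ‖maskL R A₁ (N s' v)‖ := h1
    _ ≤ Real.exp (-(r * L')) * ‖N s' v‖ := by
        rw [show e' - s' = L' by rw [he']; ring]
        exact mul_le_mul_of_nonneg_left (norm_maskL_le _ _) (Real.exp_pos _).le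

end Summit.AnomalousDissipation.AnomalousDissipation.Theorems.SolenoidalFractalHomogenisation.LagrangianStep.Sideband

end
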